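import Literature.NumberTheory.Automorphic.UnitaryGroupRankOneIwahoriDatum    -- ★ (F0P3-p01) the MODEL Iwahori datum `iwahoriDatumU3` of `U(σ,Φ₃)(K)` + its ray-generic dominance lemmas
import Literature.NumberTheory.Automorphic.JacquetRayShellTrace               -- ★ `exists_isLeftTransversal_conj` (finite transversal of `K ∕ (K ∩ bKb⁻¹)`)
import Summits.HodgeConjecture.HodgeConjecture.Theorems.F0P3CMBorelIwahoriDatum    -- (ED. 2) ★ T1 `exists_cmIwahoriDatum` and its model lemmas ∕ transports
import Summits.HodgeConjecture.HodgeConjecture.Theorems.F0P3cIwahoriDatumU2       -- (ED. 2) ★ any-rank `dominant_package` (U2-A)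
import HarnessLib

/-!
# F0 · P3c · line LH6 «StCharTS» — «DOM-GENERAL★» §1 (model level, `N = 3`): the dominance triple `hbN ∕ hbNbar ∕ hbexh` and the transversal of the
# shell-trace theorems (★ F1-G `F0P3cStCharTSShellTracePS`, ★ R2d) hold for EVERY dominant diagonal `b` of `U(σ, Φ₃)(K)`, not only for the datum's ray
# [Casselman1995, Prop. 1.4.3, Prop. 1.4.4; Rogawski1990, §12.7 L. 12.7.1 (proof) p. 191]

Cell `pub/hodgecm-mathlib`, crux H413 = `stmt-HodgeConjecture-24833` (`--supports` lane, helper), route HCCMUnconditional; seat LH6-p05 (g2); road (D) owner LH6-p04 (g3)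
DEAL «DOM-GENERAL★» 2026-09-02T06:33:59Z.  THEOREMS ONLY, sorry-free, no definition ∕ instance ∕ notation ∕ named fact.
THE POINT.  ★ `UnitaryGroup.iwahoriDatumU3 σ hJ hσc hγ₀0 hγ₀1 hq0 hq1 s₀ u₀ hs₀ hu₀` (one-place model `U = U(σ,Φ₃)(K)`, `K` a non-archimedean local field) is built
along ONE diagonal ray `s₀`, but its levels `K_j = U ∩ K_{γ₀^{j+1}}` and its opposite radical `N̄ = w₀Nw₀` do not depend on `s₀` (★ `iwahoriDatumU3_K`,
`iwahoriDatumU3_Nbar` are `rfl`), and ★ `conj_mem_comap_congruenceGL_of_mem_N` ∕ `inv_conj_mem_of_mem_Nbar` ∕ `exists_forall_pow_conj_mem` are stated for ANY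
diagonal `s = diag(u)` with `|u_i∕u_j| ≤ q′` (`i < j`).  Hence:
* **`iwahoriDatumU3_dominant_of_diagonal`** — for EVERY dominant diagonal `s` (`|u_i∕u_j| ≤ q′ < 1` for `i < j`) and every level `j`: `s (K_j ∩ N) s⁻¹ ⊆ K_j`
  (`hbN`), `s⁻¹ (K_j ∩ N̄) s ⊆ K_j ∩ N̄` (`hbNbar`), every `n ∈ N` is eventually conjugated into `K_j` by the powers of `s` (`hbexh`) — the binder triple of ★
  `smoothTrace_cmPrincipalSeries_indicator_shell_eq_ite` ∕ ★ `Representation.smoothTrace_indicator_shell_eq` at a GENERAL shell point `b`, as «SURJ-HECKE★»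
  (`hshell` at every dominant `u`) and road (D)'s oriented shell points `u_j` need;
* `exists_isLeftTransversal_iwahoriDatumU3` — the transversal `R` of `K_j ∕ (K_j ∩ bK_jb⁻¹)` for every `b` (★ `exists_isLeftTransversal_conj`).
(ED. 2) §2 = the transport to the CM carrier `U(Φ₃)(L⁺_v)` along ★ `localNonsplitEquiv`: `exists_isLeftTransversal_cmLevel` (F1-G's `R` for every `b`),
**`dominant_of_levels`** (F1-G's `hbN ∕ hbNbar ∕ hbexh` at EVERY dominant torus element `b`, from the concrete level ∕ `N̄` description) and
**`exists_cmIwahoriDatum_levels`** (★ T1 `exists_cmIwahoriDatum` + the two bookkeeping clauses `𝓘.K n = e⁻¹(U′ ∩ K_{|α|^{n+1}})`, `𝓘.Nbar = e⁻¹(w₀N′w₀)` its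
existential hides).  The `N = 2` twins are ★ `F0P3cIwahoriDatumU2` (model, any rank) ∕ ★ `F0P3cCMBorelIwahoriDatumU2` ∕ ★ `F0P3cStCharTSDomGeneralH`.
HONEST LABEL: HC_CM is proved only modulo the 7 printed citations (2 remaining: hLiu418 = stmt-HodgeConjecture-24832, h413 = stmt-HodgeConjecture-24833) until rung 0
closes; count-neutral.

## References
* [Casselman1995] W. Casselman, *Introduction to the theory of admissible representations of `p`-adic reductive groups* (1995 notes): Prop. 1.4.3, Prop. 1.4.4
  (Iwahori factorisation, dominance of `a` on `N`, expansion on `N̄`), §4.1 (the index `[KaK : K]`).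
* [Rogawski1990] J. D. Rogawski, *Automorphic Representations of Unitary Groups in Three Variables*, Ann. of Math. Stud. 123 (1990): §12.7 L. 12.7.1 (proof) p. 191
  (Hecke functions on the shells `η^m𝒪^*`).
-/

set_option autoImplicit false
-- the mandated namespace has the single-problem summit's repeated segment (`HodgeConjecture.HodgeConjecture`)
set_option linter.dupNamespace false

noncomputable section

open scoped MatrixGroups Pointwise Topology
open ValuativeRel Matrix
open Literature.NumberTheory.Automorphic Literature.NumberTheory.Automorphic.UnitaryGroup

namespace Summit.HodgeConjecture.HodgeConjecture.Cruxes.H413.F0P3cStCharTSDomGeneral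

variable {K : Type*} [Field K] [ValuativeRel K] [TopologicalSpace K] [IsNonarchimedeanLocalField K]
  (σ : K →+* K) {J : Matrix (Fin 3) (Fin 3) K} (hJ : J = (StdForm.antidiagonal 3).over K)

/-- **«DOM-GENERAL★» (model, `N = 3`): the dominance triple at EVERY dominant diagonal element.**  For the model Iwahori datum `𝓘 = iwahoriDatumU3 … s₀ u₀ …`
(any fixed ray `s₀`) and ANY diagonal `s = diag(u) ∈ U(σ,Φ₃)(K)` with `|u_i∕u_j| ≤ q′ < 1` for `i < j`, at every level `j`: `hbN`, `hbNbar`, `hbexh` — the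
statement of ★ `iwahoriDatumU3_dominant` with the ray replaced by `s` (same proofs: the levels and `N̄` of `𝓘` do not involve the ray).
[cite: Casselman1995, Prop. 1.4.3, Prop. 1.4.4] [cite: Rogawski1990, §12.7 L. 12.7.1 (proof) p. 191] -/
theorem iwahoriDatumU3_dominant_of_diagonal (hσc : Continuous σ) {γ₀ : ValueGroupWithZero K} (hγ₀0 : γ₀ ≠ 0) (hγ₀1 : γ₀ < 1)
    {q : ValueGroupWithZero K} (hq0 : q ≠ 0) (hq1 : q < 1) (s₀ : ↥(unitaryGroupOfForm σ J)) (u₀ : Fin 3 → Kˣ)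
    (hs₀ : ((s₀ : ↥(unitaryGroupOfForm σ J)) : GL (Fin 3) K) = glDiagonal 3 K u₀)
    (hu₀ : ∀ i j : Fin 3, i < j → valuation K ((u₀ i : K) * ((u₀ j : K))⁻¹) ≤ q)
    {q' : ValueGroupWithZero K} (hq'0 : q' ≠ 0) (hq'1 : q' < 1) (s : ↥(unitaryGroupOfForm σ J)) (u : Fin 3 → Kˣ)
    (hs : ((s : ↥(unitaryGroupOfForm σ J)) : GL (Fin 3) K) = glDiagonal 3 K u)
    (hu : ∀ i j : Fin 3, i < j → valuation K ((u i : K) * ((u j : K))⁻¹) ≤ q') (j : ℕ) :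
    (∀ x ∈ (iwahoriDatumU3 σ hJ hσc hγ₀0 hγ₀1 hq0 hq1 s₀ u₀ hs₀ hu₀).K j ⊓ (borelTriple σ J hJ).N,
        s * x * s⁻¹ ∈ (iwahoriDatumU3 σ hJ hσc hγ₀0 hγ₀1 hq0 hq1 s₀ u₀ hs₀ hu₀).K j) ∧
    (∀ x ∈ (iwahoriDatumU3 σ hJ hσc hγ₀0 hγ₀1 hq0 hq1 s₀ u₀ hs₀ hu₀).K j ⊓ (iwahoriDatumU3 σ hJ hσc hγ₀0 hγ₀1 hq0 hq1 s₀ u₀ hs₀ hu₀).Nbar,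
        s⁻¹ * x * s ∈ (iwahoriDatumU3 σ hJ hσc hγ₀0 hγ₀1 hq0 hq1 s₀ u₀ hs₀ hu₀).K j ⊓ (iwahoriDatumU3 σ hJ hσc hγ₀0 hγ₀1 hq0 hq1 s₀ u₀ hs₀ hu₀).Nbar) ∧
    (∀ n ∈ (borelTriple σ J hJ).N, ∃ m : ℕ, ∀ m' : ℕ, m ≤ m' →
        s ^ m' * n * (s ^ m')⁻¹ ∈ (iwahoriDatumU3 σ hJ hσc hγ₀0 hγ₀1 hq0 hq1 s₀ u₀ hs₀ hu₀).K j) := by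
  have hγ : γ₀ ^ (j + 1) < 1 := pow_lt_one₀ zero_le hγ₀1 (Nat.succ_ne_zero j)
  refine ⟨fun x hx => conj_mem_comap_congruenceGL_of_mem_N σ hJ hγ hq'1.le s u hs hu hx, fun x hx => ?_,
    fun n hn => exists_forall_pow_conj_mem σ hJ hq'0 hq'1 (pow_ne_zero _ hγ₀0) hγ s u hs hu hn⟩
  exact inv_conj_mem_of_mem_Nbar σ hJ hγ ((mul_le_mul' hq'1.le le_rfl).trans (one_mul _).le) s u hs hu hx

/-- The three clauses separately, in the binder names of ★ F1-G ∕ R2d (`hbN`). [cite: Casselman1995, Prop. 1.4.3] -/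
theorem hbN_of_diagonal (hσc : Continuous σ) {γ₀ : ValueGroupWithZero K} (hγ₀0 : γ₀ ≠ 0) (hγ₀1 : γ₀ < 1)
    {q : ValueGroupWithZero K} (hq0 : q ≠ 0) (hq1 : q < 1) (s₀ : ↥(unitaryGroupOfForm σ J)) (u₀ : Fin 3 → Kˣ)
    (hs₀ : ((s₀ : ↥(unitaryGroupOfForm σ J)) : GL (Fin 3) K) = glDiagonal 3 K u₀)
    (hu₀ : ∀ i j : Fin 3, i < j → valuation K ((u₀ i : K) * ((u₀ j : K))⁻¹) ≤ q)
    {q' : ValueGroupWithZero K} (hq'1 : q' < 1) (s : ↥(unitaryGroupOfForm σ J)) (u : Fin 3 → Kˣ)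
    (hs : ((s : ↥(unitaryGroupOfForm σ J)) : GL (Fin 3) K) = glDiagonal 3 K u)
    (hu : ∀ i j : Fin 3, i < j → valuation K ((u i : K) * ((u j : K))⁻¹) ≤ q') (j : ℕ) :
    ∀ x ∈ (iwahoriDatumU3 σ hJ hσc hγ₀0 hγ₀1 hq0 hq1 s₀ u₀ hs₀ hu₀).K j ⊓ (borelTriple σ J hJ).N,
      s * x * s⁻¹ ∈ (iwahoriDatumU3 σ hJ hσc hγ₀0 hγ₀1 hq0 hq1 s₀ u₀ hs₀ hu₀).K j :=
  fun _ hx => conj_mem_comap_congruenceGL_of_mem_N σ hJ (pow_lt_one₀ zero_le hγ₀1 (Nat.succ_ne_zero j)) hq'1.le s u hs hu hx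

/-- (`hbNbar`). [cite: Casselman1995, Prop. 1.4.3] -/
theorem hbNbar_of_diagonal (hσc : Continuous σ) {γ₀ : ValueGroupWithZero K} (hγ₀0 : γ₀ ≠ 0) (hγ₀1 : γ₀ < 1)
    {q : ValueGroupWithZero K} (hq0 : q ≠ 0) (hq1 : q < 1) (s₀ : ↥(unitaryGroupOfForm σ J)) (u₀ : Fin 3 → Kˣ)
    (hs₀ : ((s₀ : ↥(unitaryGroupOfForm σ J)) : GL (Fin 3) K) = glDiagonal 3 K u₀)
    (hu₀ : ∀ i j : Fin 3, i < j → valuation K ((u₀ i : K) * ((u₀ j : K))⁻¹) ≤ q)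
    {q' : ValueGroupWithZero K} (hq'1 : q' < 1) (s : ↥(unitaryGroupOfForm σ J)) (u : Fin 3 → Kˣ)
    (hs : ((s : ↥(unitaryGroupOfForm σ J)) : GL (Fin 3) K) = glDiagonal 3 K u)
    (hu : ∀ i j : Fin 3, i < j → valuation K ((u i : K) * ((u j : K))⁻¹) ≤ q') (j : ℕ) :
    ∀ x ∈ (iwahoriDatumU3 σ hJ hσc hγ₀0 hγ₀1 hq0 hq1 s₀ u₀ hs₀ hu₀).K j ⊓ (iwahoriDatumU3 σ hJ hσc hγ₀0 hγ₀1 hq0 hq1 s₀ u₀ hs₀ hu₀).Nbar,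
      s⁻¹ * x * s ∈ (iwahoriDatumU3 σ hJ hσc hγ₀0 hγ₀1 hq0 hq1 s₀ u₀ hs₀ hu₀).K j ⊓ (iwahoriDatumU3 σ hJ hσc hγ₀0 hγ₀1 hq0 hq1 s₀ u₀ hs₀ hu₀).Nbar :=
  fun _ hx => inv_conj_mem_of_mem_Nbar σ hJ (pow_lt_one₀ zero_le hγ₀1 (Nat.succ_ne_zero j)) ((mul_le_mul' hq'1.le le_rfl).trans (one_mul _).le) s u hs hu hx

/-- (`hbexh`). [cite: Casselman1995, Prop. 1.4.3] -/
theorem hbexh_of_diagonal (hσc : Continuous σ) {γ₀ : ValueGroupWithZero K} (hγ₀0 : γ₀ ≠ 0) (hγ₀1 : γ₀ < 1)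
    {q : ValueGroupWithZero K} (hq0 : q ≠ 0) (hq1 : q < 1) (s₀ : ↥(unitaryGroupOfForm σ J)) (u₀ : Fin 3 → Kˣ)
    (hs₀ : ((s₀ : ↥(unitaryGroupOfForm σ J)) : GL (Fin 3) K) = glDiagonal 3 K u₀)
    (hu₀ : ∀ i j : Fin 3, i < j → valuation K ((u₀ i : K) * ((u₀ j : K))⁻¹) ≤ q)
    {q' : ValueGroupWithZero K} (hq'0 : q' ≠ 0) (hq'1 : q' < 1) (s : ↥(unitaryGroupOfForm σ J)) (u : Fin 3 → Kˣ)
    (hs : ((s : ↥(unitaryGroupOfForm σ J)) : GL (Fin 3) K) = glDiagonal 3 K u)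
    (hu : ∀ i j : Fin 3, i < j → valuation K ((u i : K) * ((u j : K))⁻¹) ≤ q') (j : ℕ) :
    ∀ n ∈ (borelTriple σ J hJ).N, ∃ m : ℕ, ∀ m' : ℕ, m ≤ m' →
      s ^ m' * n * (s ^ m')⁻¹ ∈ (iwahoriDatumU3 σ hJ hσc hγ₀0 hγ₀1 hq0 hq1 s₀ u₀ hs₀ hu₀).K j :=
  fun _ hn => exists_forall_pow_conj_mem σ hJ hq'0 hq'1 (pow_ne_zero _ hγ₀0) (pow_lt_one₀ zero_le hγ₀1 (Nat.succ_ne_zero j)) s u hs hu hn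

/-- **The transversal at every shell point**: `K_j ∕ (K_j ∩ bK_jb⁻¹)` has a finite left transversal for EVERY `b` (the `R` of ★ F1-G ∕ R2d).
[cite: Casselman1995, §4.1] -/
theorem exists_isLeftTransversal_iwahoriDatumU3 (hσc : Continuous σ) {γ₀ : ValueGroupWithZero K} (hγ₀0 : γ₀ ≠ 0) (hγ₀1 : γ₀ < 1)
    {q : ValueGroupWithZero K} (hq0 : q ≠ 0) (hq1 : q < 1) (s₀ : ↥(unitaryGroupOfForm σ J)) (u₀ : Fin 3 → Kˣ)
    (hs₀ : ((s₀ : ↥(unitaryGroupOfForm σ J)) : GL (Fin 3) K) = glDiagonal 3 K u₀)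
    (hu₀ : ∀ i j : Fin 3, i < j → valuation K ((u₀ i : K) * ((u₀ j : K))⁻¹) ≤ q) (j : ℕ) (b : ↥(unitaryGroupOfForm σ J)) :
    ∃ R : Finset ↥(unitaryGroupOfForm σ J),
      IsLeftTransversal ((iwahoriDatumU3 σ hJ hσc hγ₀0 hγ₀1 hq0 hq1 s₀ u₀ hs₀ hu₀).K j)
        ((iwahoriDatumU3 σ hJ hσc hγ₀0 hγ₀1 hq0 hq1 s₀ u₀ hs₀ hu₀).K j ⊓
          ConjAct.toConjAct b • (iwahoriDatumU3 σ hJ hσc hγ₀0 hγ₀1 hq0 hq1 s₀ u₀ hs₀ hu₀).K j) R :=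
  Representation.exists_isLeftTransversal_conj ((iwahoriDatumU3 σ hJ hσc hγ₀0 hγ₀1 hq0 hq1 s₀ u₀ hs₀ hu₀).isCompact_K j)
    ((iwahoriDatumU3 σ hJ hσc hγ₀0 hγ₀1 hq0 hq1 s₀ u₀ hs₀ hu₀).isOpen_K j) b


/-! ## (ED. 2) §2 The CM carrier `U(Φ₃)(L⁺_v)` at a non-split place: dominance at EVERY dominant torus element from CONCRETE levels, the transversal,
and the (T1) package WITH ITS LEVELS EXPOSED -/

section CM

open scoped WithZero
open Literature.NumberTheory _root_.NumberField _root_.IsDedekindDomain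
open Summit.HodgeConjecture.HodgeConjecture.Cruxes.H413.F0P3CMBorelIwahoriDatum

variable (L : Type) [Field L] [NumberField L] [IsCMField L] (v : HeightOneSpectrum (𝓞 ↥(maximalRealSubfield L)))
  (w : PlacesOver L v) (hw : IsCMField.complexConj L • w.1 = w.1)

/-- **F1-G's transversal `R` for EVERY `b ∈ U(Φ₃)(L⁺_v)`** and every Iwahori datum: `K_n` is compact open, so `K_n ∩ bK_nb⁻¹` has a finite left transversal
(★ `Representation.exists_isLeftTransversal_conj`; the `N = 2` twin is ★ `F0P3cStCharTSDomGeneralH.exists_isLeftTransversal_K`). [cite: Casselman1995, §4.1] -/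
theorem exists_isLeftTransversal_cmLevel (𝓘 : (cmBorelTriple L 3 v).IwahoriDatum) (n : ℕ)
    (b : ↥(unitaryGroupOfForm (conjLocal L (IsCMField.complexConj L) v) (cmLocalForm L 3 v))) :
    ∃ R : Finset ↥(unitaryGroupOfForm (conjLocal L (IsCMField.complexConj L) v) (cmLocalForm L 3 v)),
      IsLeftTransversal (𝓘.K n) (𝓘.K n ⊓ ConjAct.toConjAct b • 𝓘.K n) R :=
  Representation.exists_isLeftTransversal_conj (𝓘.isCompact_K n) (𝓘.isOpen_K n) b

/-- **«DOM-GENERAL★» ON THE CM CARRIER (`N = 3`): dominance at EVERY dominant torus element, from the CONCRETE level description.**  For ANY Iwahori datum `𝓘`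
of ★ `cmBorelTriple L 3 v` whose levels are the pull-backs `K_n = e⁻¹(U′ ∩ K_{γ₀^{n+1}})` along the one-place model `e = localNonsplitEquiv` and whose opposite
radical is `e⁻¹(w₀N′w₀)` (the two bookkeeping clauses of `exists_cmIwahoriDatum_levels` below, `γ₀ = |α|_w`), and ANY `b` whose model image is a diagonal
`e b = diag(d)` with `|d_i∕d_j|_w ≤ q′ < 1` for `i < j`: F1-G's `hbN`, `hbNbar`, `hbexh` at `b` and every level `n` — ★ any-rank `F0P3cIwahoriDatumU2.dominant_package`
on the model pulled back by ★ `StructureTransport.comap_conj_mem ∕ comap_inv_conj_mem_inf ∕ comap_exhaustion` (the three lines of T1's clauses 7–9, at `b`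
instead of the ray). [cite: Casselman1995, Prop. 1.4.3, Prop. 1.4.4] [cite: PlatonovRapinchuk1994, §5.1] -/
theorem dominant_of_levels (𝓘 : (cmBorelTriple L 3 v).IwahoriDatum) {γ₀ : ValueGroupWithZero (w.1.adicCompletion L)} (hγ₀0 : γ₀ ≠ 0) (hγ₀1 : γ₀ < 1)
    (hK : ∀ n, 𝓘.K n = ((congruenceGL 3 (γ₀ ^ (n + 1))).comap (unitaryGroupOfForm (galAdicCompletionMap (L := L) (IsCMField.complexConj L) hw) (placeForm (Rogawski1990.qsForm L) w.1)).subtype).comap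
        ((localNonsplitEquiv (IsCMField.complexConj L) (Rogawski1990.qsForm L) (IsCMField.complexConj_ne_one L) w hw) : ↥(«local» L (IsCMField.complexConj L) 3 (Rogawski1990.qsForm L) v) →* ↥(unitaryGroupOfForm (galAdicCompletionMap (L := L) (IsCMField.complexConj L) hw) (placeForm (Rogawski1990.qsForm L) w.1))))
    (hNbar : 𝓘.Nbar = (((borelTriple (galAdicCompletionMap (L := L) (IsCMField.complexConj L) hw) (placeForm (Rogawski1990.qsForm L) w.1) (placeForm_qsForm_eq L v w)).N).map (MulAut.conj (weylLongU (galAdicCompletionMap (L := L) (IsCMField.complexConj L) hw) (placeForm_qsForm_eq L v w))).toMonoidHom).comap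
        ((localNonsplitEquiv (IsCMField.complexConj L) (Rogawski1990.qsForm L) (IsCMField.complexConj_ne_one L) w hw) : ↥(«local» L (IsCMField.complexConj L) 3 (Rogawski1990.qsForm L) v) →* ↥(unitaryGroupOfForm (galAdicCompletionMap (L := L) (IsCMField.complexConj L) hw) (placeForm (Rogawski1990.qsForm L) w.1))))
    (b : ↥(unitaryGroupOfForm (conjLocal L (IsCMField.complexConj L) v) (cmLocalForm L 3 v)))
    {q' : ValueGroupWithZero (w.1.adicCompletion L)} (hq'0 : q' ≠ 0) (hq'1 : q' < 1) (d : Fin 3 → (w.1.adicCompletion L)ˣ)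
    (hb : (((localNonsplitEquiv (IsCMField.complexConj L) (Rogawski1990.qsForm L) (IsCMField.complexConj_ne_one L) w hw) b : ↥(unitaryGroupOfForm (galAdicCompletionMap (L := L) (IsCMField.complexConj L) hw) (placeForm (Rogawski1990.qsForm L) w.1))) :
        GL (Fin 3) (w.1.adicCompletion L)) = glDiagonal 3 (w.1.adicCompletion L) d)
    (hd : ∀ i j : Fin 3, i < j → valuation (w.1.adicCompletion L) ((d i : w.1.adicCompletion L) * ((d j : w.1.adicCompletion L))⁻¹) ≤ q') (n : ℕ) :
    (∀ x ∈ 𝓘.K n ⊓ (cmBorelTriple L 3 v).N, b * x * b⁻¹ ∈ 𝓘.K n) ∧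
    (∀ x ∈ 𝓘.K n ⊓ 𝓘.Nbar, b⁻¹ * x * b ∈ 𝓘.K n ⊓ 𝓘.Nbar) ∧
    (∀ x ∈ (cmBorelTriple L 3 v).N, ∃ m : ℕ, ∀ m', m ≤ m' → b ^ m' * x * (b ^ m')⁻¹ ∈ 𝓘.K n) := by
  have hσc : Continuous (galAdicCompletionMap (L := L) (IsCMField.complexConj L) hw) := continuous_galAdicCompletionMap (L := L) (IsCMField.complexConj L) hw
  have hdom := F0P3cIwahoriDatumU2.dominant_package (galAdicCompletionMap (L := L) (IsCMField.complexConj L) hw) (placeForm_qsForm_eq L v w) hγ₀0 hγ₀1 hq'0 hq'1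
    ((localNonsplitEquiv (IsCMField.complexConj L) (Rogawski1990.qsForm L) (IsCMField.complexConj_ne_one L) w hw) b) d hb hd n
  have hsymm : (localNonsplitEquiv (IsCMField.complexConj L) (Rogawski1990.qsForm L) (IsCMField.complexConj_ne_one L) w hw).symm
      ((localNonsplitEquiv (IsCMField.complexConj L) (Rogawski1990.qsForm L) (IsCMField.complexConj_ne_one L) w hw) b) = b :=
    (localNonsplitEquiv (IsCMField.complexConj L) (Rogawski1990.qsForm L) (IsCMField.complexConj_ne_one L) w hw).symm_apply_apply _
  have hNe : ((borelTriple (galAdicCompletionMap (L := L) (IsCMField.complexConj L) hw) (placeForm (Rogawski1990.qsForm L) w.1) (placeForm_qsForm_eq L v w)).N).comap ((localNonsplitEquiv (IsCMField.complexConj L) (Rogawski1990.qsForm L) (IsCMField.complexConj_ne_one L) w hw) : ↥(«local» L (IsCMField.complexConj L) 3 (Rogawski1990.qsForm L) v) →* ↥(unitaryGroupOfForm (galAdicCompletionMap (L := L) (IsCMField.complexConj L) hw) (placeForm (Rogawski1990.qsForm L) w.1))) = (cmBorelTriple L 3 v).N := comap_localNonsplitEquiv_unipotentU L v w hw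
  refine ⟨?_, ?_, ?_⟩
  · intro x hx
    rw [hK n, ← hNe] at hx
    have h1 := StructureTransport.comap_conj_mem (localNonsplitEquiv (IsCMField.complexConj L) (Rogawski1990.qsForm L) (IsCMField.complexConj_ne_one L) w hw) hdom.1 x hx
    rw [hsymm] at h1
    rw [hK n]
    exact h1
  · intro x hx
    rw [hK n, hNbar] at hx
    have h1 := StructureTransport.comap_inv_conj_mem_inf (localNonsplitEquiv (IsCMField.complexConj L) (Rogawski1990.qsForm L) (IsCMField.complexConj_ne_one L) w hw) hdom.2.1 x hx
    rw [hsymm] at h1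
    rw [hK n, hNbar]
    exact h1
  · intro x hx
    rw [← hNe] at hx
    obtain ⟨m, hm⟩ := StructureTransport.comap_exhaustion (localNonsplitEquiv (IsCMField.complexConj L) (Rogawski1990.qsForm L) (IsCMField.complexConj_ne_one L) w hw) hdom.2.2.1 x hx
    refine ⟨m, fun m' hm' => ?_⟩
    have h1 := hm m' hm'
    rw [hsymm] at h1
    rw [hK n]
    exact h1

set_option maxHeartbeats 1600000 in  -- as ★ T1 `exists_cmIwahoriDatum`: long defeq unfoldings of `cmLocalForm`∕`qsForm` in every transported clause
/-- **THE CM IWAHORI DATUM PACKAGE (T1) WITH ITS LEVELS EXPOSED.**  ★ `F0P3CMBorelIwahoriDatum.exists_cmIwahoriDatum` VERBATIM (its 12 clauses, same proof) plus the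
two bookkeeping clauses its existential hides: `𝓘.K n = e⁻¹(U′ ∩ K_{|α|_w^{n+1}})` and `𝓘.Nbar = e⁻¹(w₀N′w₀)` — the inputs of `dominant_of_levels` (dominance at EVERY
dominant torus element, for (SHF′) item (1) ∕ F1-G at a general shell point) and of the `hiff` dischargers (`w₀`-stability of the levels). [cite: Casselman1995, Prop. 1.4.4 p. 14,
§1.5 Lemma 1.5.1 p. 16, Thm. 4.4.6 p. 45] [cite: PlatonovRapinchuk1994, §5.1] [cite: Rogawski1990, §1.10 p. 9] -/
theorem exists_cmIwahoriDatum_levels (a : ↥(torusU (conjLocal L (IsCMField.complexConj L) v) (cmLocalForm L 3 v)))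
    {α : w.1.adicCompletion L} (hα0 : α ≠ 0) (hα1 : Valued.v α < 1)
    (ha : ((((localNonsplitEquiv (IsCMField.complexConj L) (Rogawski1990.qsForm L) (IsCMField.complexConj_ne_one L) w hw) (a : ↥(unitaryGroupOfForm (conjLocal L (IsCMField.complexConj L) v) (cmLocalForm L 3 v))) : ↥(unitaryGroupOfForm (galAdicCompletionMap (L := L) (IsCMField.complexConj L) hw) (placeForm (Rogawski1990.qsForm L) w.1))) : GL (Fin 3) (w.1.adicCompletion L)) : Matrix (Fin 3) (Fin 3) (w.1.adicCompletion L)) =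
      Matrix.diagonal ![α, 1, ((galAdicCompletionMap (L := L) (IsCMField.complexConj L) hw) α)⁻¹]) :
    ∃ (𝓘 : (cmBorelTriple L 3 v).IwahoriDatum) (K₀ : Subgroup ↥(unitaryGroupOfForm (conjLocal L (IsCMField.complexConj L) v) (cmLocalForm L 3 v))),
      𝓘.a = (a : ↥(unitaryGroupOfForm (conjLocal L (IsCMField.complexConj L) v) (cmLocalForm L 3 v))) ∧ IsCompact (K₀ : Set ↥(unitaryGroupOfForm (conjLocal L (IsCMField.complexConj L) v) (cmLocalForm L 3 v))) ∧ IsOpen (K₀ : Set ↥(unitaryGroupOfForm (conjLocal L (IsCMField.complexConj L) v) (cmLocalForm L 3 v))) ∧ Subgroup.center ↥(unitaryGroupOfForm (conjLocal L (IsCMField.complexConj L) v) (cmLocalForm L 3 v)) ≤ K₀ ∧ (∀ n, 𝓘.K n ≤ K₀) ∧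
      (∀ n, ∀ k ∈ K₀, ∀ κ ∈ 𝓘.K n, k⁻¹ * κ * k ∈ 𝓘.K n) ∧
      (∀ n, ∀ x ∈ 𝓘.K n ⊓ (cmBorelTriple L 3 v).N, 𝓘.a * x * 𝓘.a⁻¹ ∈ 𝓘.K n) ∧
      (∀ n, ∀ x ∈ 𝓘.K n ⊓ 𝓘.Nbar, 𝓘.a⁻¹ * x * 𝓘.a ∈ 𝓘.K n ⊓ 𝓘.Nbar) ∧
      (∀ n, ∀ x ∈ (cmBorelTriple L 3 v).N, ∃ m : ℕ, ∀ m', m ≤ m' → 𝓘.a ^ m' * x * (𝓘.a ^ m')⁻¹ ∈ 𝓘.K n) ∧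
      (∀ nb ∈ 𝓘.Nbar, ∀ m ∈ (cmBorelTriple L 3 v).M, ∀ n ∈ (cmBorelTriple L 3 v).N, ∀ nb' ∈ 𝓘.Nbar, ∀ m' ∈ (cmBorelTriple L 3 v).M,
          ∀ n' ∈ (cmBorelTriple L 3 v).N, nb * m * n = nb' * m' * n' → n = n') ∧
      (∀ n, Pairwise (Function.onFun Disjoint fun m : ℕ =>
          (QuotientGroup.mk : ↥(unitaryGroupOfForm (conjLocal L (IsCMField.complexConj L) v) (cmLocalForm L 3 v)) → ↥(unitaryGroupOfForm (conjLocal L (IsCMField.complexConj L) v) (cmLocalForm L 3 v)) ⧸ Subgroup.center ↥(unitaryGroupOfForm (conjLocal L (IsCMField.complexConj L) v) (cmLocalForm L 3 v))) '' DoubleCoset.doubleCoset (𝓘.a ^ m) (𝓘.K n : Set ↥(unitaryGroupOfForm (conjLocal L (IsCMField.complexConj L) v) (cmLocalForm L 3 v))) (𝓘.K n))) ∧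
      (∀ k : ↥(unitaryGroupOfForm (conjLocal L (IsCMField.complexConj L) v) (cmLocalForm L 3 v)), k ∈ K₀ ↔ ((((localNonsplitEquiv (IsCMField.complexConj L) (Rogawski1990.qsForm L) (IsCMField.complexConj_ne_one L) w hw) k : ↥(unitaryGroupOfForm (galAdicCompletionMap (L := L) (IsCMField.complexConj L) hw) (placeForm (Rogawski1990.qsForm L) w.1))) : GL (Fin 3) (w.1.adicCompletion L)) ∈ glInt 3 (w.1.adicCompletion L))) ∧
      (∀ n, 𝓘.K n = ((congruenceGL 3 ((valuation (w.1.adicCompletion L) α) ^ (n + 1))).comap (unitaryGroupOfForm (galAdicCompletionMap (L := L) (IsCMField.complexConj L) hw) (placeForm (Rogawski1990.qsForm L) w.1)).subtype).comap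
        ((localNonsplitEquiv (IsCMField.complexConj L) (Rogawski1990.qsForm L) (IsCMField.complexConj_ne_one L) w hw) : ↥(«local» L (IsCMField.complexConj L) 3 (Rogawski1990.qsForm L) v) →* ↥(unitaryGroupOfForm (galAdicCompletionMap (L := L) (IsCMField.complexConj L) hw) (placeForm (Rogawski1990.qsForm L) w.1)))) ∧
      𝓘.Nbar = (((borelTriple (galAdicCompletionMap (L := L) (IsCMField.complexConj L) hw) (placeForm (Rogawski1990.qsForm L) w.1) (placeForm_qsForm_eq L v w)).N).map (MulAut.conj (weylLongU (galAdicCompletionMap (L := L) (IsCMField.complexConj L) hw) (placeForm_qsForm_eq L v w))).toMonoidHom).comap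
        ((localNonsplitEquiv (IsCMField.complexConj L) (Rogawski1990.qsForm L) (IsCMField.complexConj_ne_one L) w hw) : ↥(«local» L (IsCMField.complexConj L) 3 (Rogawski1990.qsForm L) v) →* ↥(unitaryGroupOfForm (galAdicCompletionMap (L := L) (IsCMField.complexConj L) hw) (placeForm (Rogawski1990.qsForm L) w.1))) := by
  haveI : CharZero (w.1.adicCompletion L) := charZero_of_injective_algebraMap (algebraMap L (w.1.adicCompletion L)).injective
  have hJw := placeForm_qsForm_eq L v w
  have hσσ := galAdicCompletionMap_involutive L v w hw
  have hσv : ∀ x, Valued.v ((galAdicCompletionMap (L := L) (IsCMField.complexConj L) hw) x) = Valued.v x := fun x => valued_galAdicCompletionMap (L := L) (IsCMField.complexConj L) hw x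
  have hσc : Continuous (galAdicCompletionMap (L := L) (IsCMField.complexConj L) hw) := continuous_galAdicCompletionMap (L := L) (IsCMField.complexConj L) hw
  -- the ray data of `e a`, the model datum and its dominance package
  obtain ⟨u, hsu, hu, hq0, hq1⟩ := exists_units_of_coe_eq_diagonal L v w hw hα0 hα1 _ ha
  have hdom := fun j => iwahoriDatumU3_dominant (galAdicCompletionMap (L := L) (IsCMField.complexConj L) hw) hJw hσc hq0 hq1 hq0 hq1 ((localNonsplitEquiv (IsCMField.complexConj L) (Rogawski1990.qsForm L) (IsCMField.complexConj_ne_one L) w hw) (a : ↥(unitaryGroupOfForm (conjLocal L (IsCMField.complexConj L) v) (cmLocalForm L 3 v)))) u hsu hu j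
  -- transport of the datum
  obtain ⟨𝓘, hNbar, ha𝓘, hK⟩ := StructureTransport.exists_iwahoriDatum_comap (localNonsplitEquiv (IsCMField.complexConj L) (Rogawski1990.qsForm L) (IsCMField.complexConj_ne_one L) w hw) (cmBorelTriple L 3 v) (borelTriple (galAdicCompletionMap (L := L) (IsCMField.complexConj L) hw) (placeForm (Rogawski1990.qsForm L) w.1) (placeForm_qsForm_eq L v w))
    (comap_localNonsplitEquiv_torusU L v w hw) (comap_localNonsplitEquiv_unipotentU L v w hw)
    (iwahoriDatumU3 (galAdicCompletionMap (L := L) (IsCMField.complexConj L) hw) hJw hσc hq0 hq1 hq0 hq1 ((localNonsplitEquiv (IsCMField.complexConj L) (Rogawski1990.qsForm L) (IsCMField.complexConj_ne_one L) w hw) (a : ↥(unitaryGroupOfForm (conjLocal L (IsCMField.complexConj L) v) (cmLocalForm L 3 v)))) u hsu hu)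
  have hsymm : (localNonsplitEquiv (IsCMField.complexConj L) (Rogawski1990.qsForm L) (IsCMField.complexConj_ne_one L) w hw).symm ((localNonsplitEquiv (IsCMField.complexConj L) (Rogawski1990.qsForm L) (IsCMField.complexConj_ne_one L) w hw) (a : ↥(unitaryGroupOfForm (conjLocal L (IsCMField.complexConj L) v) (cmLocalForm L 3 v)))) = (a : ↥(unitaryGroupOfForm (conjLocal L (IsCMField.complexConj L) v) (cmLocalForm L 3 v))) := (localNonsplitEquiv (IsCMField.complexConj L) (Rogawski1990.qsForm L) (IsCMField.complexConj_ne_one L) w hw).symm_apply_apply _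
  have ha' : 𝓘.a = (a : ↥(unitaryGroupOfForm (conjLocal L (IsCMField.complexConj L) v) (cmLocalForm L 3 v))) := by rw [ha𝓘]; exact hsymm
  have hNe : ((borelTriple (galAdicCompletionMap (L := L) (IsCMField.complexConj L) hw) (placeForm (Rogawski1990.qsForm L) w.1) (placeForm_qsForm_eq L v w)).N).comap ((localNonsplitEquiv (IsCMField.complexConj L) (Rogawski1990.qsForm L) (IsCMField.complexConj_ne_one L) w hw) : ↥(«local» L (IsCMField.complexConj L) 3 (Rogawski1990.qsForm L) v) →* ↥(unitaryGroupOfForm (galAdicCompletionMap (L := L) (IsCMField.complexConj L) hw) (placeForm (Rogawski1990.qsForm L) w.1))) = (cmBorelTriple L 3 v).N := comap_localNonsplitEquiv_unipotentU L v w hw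
  have hMe : ((borelTriple (galAdicCompletionMap (L := L) (IsCMField.complexConj L) hw) (placeForm (Rogawski1990.qsForm L) w.1) (placeForm_qsForm_eq L v w)).M).comap ((localNonsplitEquiv (IsCMField.complexConj L) (Rogawski1990.qsForm L) (IsCMField.complexConj_ne_one L) w hw) : ↥(«local» L (IsCMField.complexConj L) 3 (Rogawski1990.qsForm L) v) →* ↥(unitaryGroupOfForm (galAdicCompletionMap (L := L) (IsCMField.complexConj L) hw) (placeForm (Rogawski1990.qsForm L) w.1))) = (cmBorelTriple L 3 v).M := comap_localNonsplitEquiv_torusU L v w hw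
  refine ⟨𝓘, ((glInt 3 (w.1.adicCompletion L)).comap (unitaryGroupOfForm (galAdicCompletionMap (L := L) (IsCMField.complexConj L) hw) (placeForm (Rogawski1990.qsForm L) w.1)).subtype).comap
      ((localNonsplitEquiv (IsCMField.complexConj L) (Rogawski1990.qsForm L) (IsCMField.complexConj_ne_one L) w hw) : ↥(«local» L (IsCMField.complexConj L) 3 (Rogawski1990.qsForm L) v) →* ↥(unitaryGroupOfForm (galAdicCompletionMap (L := L) (IsCMField.complexConj L) hw) (placeForm (Rogawski1990.qsForm L) w.1))), ha', ?_, ?_, ?_, ?_, ?_, ?_, ?_, ?_, ?_, ?_, fun k => Iff.rfl, fun n => hK n, hNbar⟩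
  · -- compact
    exact StructureTransport.isCompact_coe_comap (localNonsplitEquiv (IsCMField.complexConj L) (Rogawski1990.qsForm L) (IsCMField.complexConj_ne_one L) w hw) (isCompact_comap_glInt (galAdicCompletionMap (L := L) (IsCMField.complexConj L) hw) hσc)
  · -- open
    exact StructureTransport.isOpen_coe_comap (localNonsplitEquiv (IsCMField.complexConj L) (Rogawski1990.qsForm L) (IsCMField.complexConj_ne_one L) w hw) ((isOpen_glInt 3 (w.1.adicCompletion L)).preimage continuous_subtype_val)
  · -- centre
    exact StructureTransport.center_le_comap (localNonsplitEquiv (IsCMField.complexConj L) (Rogawski1990.qsForm L) (IsCMField.complexConj_ne_one L) w hw) (center_le_comap_glInt L v w hw)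
  · -- levels inside `K₀`
    intro n x hx
    rw [hK n] at hx
    exact congruenceGL_le_glInt _ hx
  · -- normality
    intro n k hk κ hκ
    rw [hK n] at hκ ⊢
    exact StructureTransport.comap_normal (localNonsplitEquiv (IsCMField.complexConj L) (Rogawski1990.qsForm L) (IsCMField.complexConj_ne_one L) w hw) (hdom n).2.2.2 k hk κ hκ
  · -- `haN`
    intro n x hx
    rw [hK n, ← hNe] at hx
    have h1 := StructureTransport.comap_conj_mem (localNonsplitEquiv (IsCMField.complexConj L) (Rogawski1990.qsForm L) (IsCMField.complexConj_ne_one L) w hw) (hdom n).1 x hx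
    rw [hsymm] at h1
    rw [hK n, ha']
    exact h1
  · -- `haNbar`
    intro n x hx
    rw [hK n, hNbar] at hx
    have h1 := StructureTransport.comap_inv_conj_mem_inf (localNonsplitEquiv (IsCMField.complexConj L) (Rogawski1990.qsForm L) (IsCMField.complexConj_ne_one L) w hw) (hdom n).2.1 x hx
    rw [hsymm] at h1
    rw [hK n, hNbar, ha']
    exact h1
  · -- `hexh`
    intro n x hx
    rw [← hNe] at hx
    obtain ⟨m, hm⟩ := StructureTransport.comap_exhaustion (localNonsplitEquiv (IsCMField.complexConj L) (Rogawski1990.qsForm L) (IsCMField.complexConj_ne_one L) w hw) (hdom n).2.2.1 x hx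
    refine ⟨m, fun m' hm' => ?_⟩
    have h1 := hm m' hm'
    rw [hsymm] at h1
    rw [hK n, ha']
    exact h1
  · -- `hinj`
    intro nb hnb m hm n hn nb' hnb' m' hm' n' hn' h
    rw [hNbar] at hnb hnb'
    rw [← hMe] at hm hm'
    rw [← hNe] at hn hn'
    exact StructureTransport.comap_hinj (localNonsplitEquiv (IsCMField.complexConj L) (Rogawski1990.qsForm L) (IsCMField.complexConj_ne_one L) w hw) (nbar_mul_torus_mul_unipotent_inj (galAdicCompletionMap (L := L) (IsCMField.complexConj L) hw) hJw) nb hnb m hm n hn nb' hnb' m' hm' n' hn' h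
  · -- `hdisj`
    intro n
    have hK' : (iwahoriDatumU3 (galAdicCompletionMap (L := L) (IsCMField.complexConj L) hw) hJw hσc hq0 hq1 hq0 hq1 ((localNonsplitEquiv (IsCMField.complexConj L) (Rogawski1990.qsForm L) (IsCMField.complexConj_ne_one L) w hw) (a : ↥(unitaryGroupOfForm (conjLocal L (IsCMField.complexConj L) v) (cmLocalForm L 3 v)))) u hsu hu).K n ≤
        (glInt 3 (w.1.adicCompletion L)).comap (unitaryGroupOfForm (galAdicCompletionMap (L := L) (IsCMField.complexConj L) hw) (placeForm (Rogawski1990.qsForm L) w.1)).subtype :=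
      fun x hx => congruenceGL_le_glInt _ hx
    have h := EntryHeight.pairwise_disjoint_image_doubleCoset_pow (galAdicCompletionMap (L := L) (IsCMField.complexConj L) hw) hJw hσσ hσv (by norm_num) (by norm_num) hα0 hα1
      ((localNonsplitEquiv (IsCMField.complexConj L) (Rogawski1990.qsForm L) (IsCMField.complexConj_ne_one L) w hw) (a : ↥(unitaryGroupOfForm (conjLocal L (IsCMField.complexConj L) v) (cmLocalForm L 3 v)))) ha _ hK'
    have h2 := StructureTransport.comap_pairwise_disjoint_image_mk (localNonsplitEquiv (IsCMField.complexConj L) (Rogawski1990.qsForm L) (IsCMField.complexConj_ne_one L) w hw) h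
    rw [hsymm, ← hK n, ← ha'] at h2
    exact h2


end CM

end Summit.HodgeConjecture.HodgeConjecture.Cruxes.H413.F0P3cStCharTSDomGeneral

end
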